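import Literature.NumberTheory.EllipticCurves.IwasawaAlgebraProofs
import HarnessLib

/-!
# Member-level untwisting in a receptacle: `p` is regular modulo `L` in `S⟦T⟧` when `S/p` is Artinian and `L mod p`
# has a unit coefficient (the algebra of memo `Cruxes/TwinSplitIMCAtThreeMult/MEMBER-UNTWIST-RECEPTACLE-DESIGN-w2g3.md`)

Width seat `bsd-wall-utd-p2-w2` (g3), for the successor LEAD of ♭B′ stmt-BirchSwinnertonDyer-27401 (membertower v9 option:
replace the growth clause of `stub_memberInclusionMultPerLevel` by `stub_pubMuMembers`). `--supports stmt-BirchSwinnertonDyer-20694`.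
Pure commutative algebra; nothing about BSD is asserted.

* §1 `PowerSeries.eq_zero_of_mul_eq_zero_of_isUnit_coeff_of_isNilpotent_lt` — over ANY commutative ring `B`: a power series `f`
  with a unit coefficient in degree `d` and NILPOTENT coefficients below `d` is a non-zero-divisor (`f = X^d·U + n`, `U` a unit,
  `n` nilpotent; `f z = 0 ⟹ (X^dU)^N z = (−n)^N z = 0 ⟹ z = 0`).
* §2 `PowerSeries.eq_zero_of_mul_eq_zero_of_isArtinianRing` — over an ARTINIAN `B`: a power series whose coefficients lie in no
  maximal ideal (e.g. one unit coefficient) is a non-zero-divisor (localise at each maximal ideal: Artin local, maximal ideal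
  nilpotent, §1; then `eq_zero_of_localization`).
* §3 `CongruenceDescent.regular_C_of_isUnit_coeff_mod` — `S` a commutative ring, `p ∈ S` a non-zero-divisor with `S ⧸ (p)`
  Artinian, `L ∈ S⟦T⟧` with a coefficient that is a unit modulo `p`: then `C p · y ∈ (L) ⟹ y ∈ (L)` — the hypothesis `hreg` of the
  per-level / uniform descent kernels (p624691, p616714) in a member's receptacle, from «`μ(L_m) = 0` in the receptacle».
  (Fields 1971 — a power series over a Noetherian ring is a zero-divisor iff killed by a constant — is not needed.)

References: [Fields1971] D. E. Fields, Zero divisors and nilpotent elements in power series rings, Proc. AMS 27 (1971) 427–433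
(context only); [AtiyahMacdonald1969] Ch. 8 (Artin rings: Prop. 8.4 nilpotent radical, Thm. 8.7 structure), Ch. 3 (local properties).
-/

set_option autoImplicit false

noncomputable section

open scoped Classical

namespace Summit.BirchSwinnertonDyer.Rank1Residual.X11b

open PowerSeries

/-! ### §1 Unit coefficient above nilpotent ones ⟹ non-zero-divisor -/

/-- `X^k · φ = 0 ⟹ φ = 0` in `B⟦X⟧`. [folklore] -/
theorem PowerSeries.eq_zero_of_X_pow_mul_eq_zero {B : Type*} [CommRing B] (k : ℕ) (φ : B⟦X⟧) (h : X ^ k * φ = 0) :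
    φ = 0 := by
  induction k with
  | zero => simpa using h
  | succ k ih =>
      apply ih
      apply X_mul_cancel
      rw [mul_zero, ← mul_assoc, ← pow_succ', h]

/-- **A power series with a unit coefficient in degree `d` and nilpotent coefficients below `d` is a non-zero-divisor**
(any commutative coefficient ring). [cite: AtiyahMacdonald1969, Ch. 1 Ex. 5 (units and nilpotents of power series rings)] -/
theorem PowerSeries.eq_zero_of_mul_eq_zero_of_isUnit_coeff_of_isNilpotent_lt {B : Type*} [CommRing B] (f : B⟦X⟧) (d : ℕ)
    (hd : IsUnit (coeff d f)) (hlow : ∀ i < d, IsNilpotent (coeff i f)) (z : B⟦X⟧) (hz : f * z = 0) : z = 0 := by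
  -- `f = X^d · U + n`
  set U : B⟦X⟧ := mk fun i ↦ coeff (i + d) f with hU
  set n : B⟦X⟧ := ∑ m ∈ Finset.range d, C (coeff m f) * X ^ m with hn
  have hf : f = X ^ d * U + n := by
    ext i
    rw [map_add, coeff_X_pow_mul', hn, map_sum]
    simp_rw [coeff_C_mul_X_pow]
    rw [Finset.sum_ite_eq (Finset.range d) i (fun j ↦ coeff j f)]
    by_cases hi : d ≤ i
    · rw [if_pos hi, hU, coeff_mk, Nat.sub_add_cancel hi, if_neg (by simpa using hi), add_zero]
    · rw [if_neg hi, if_pos (Finset.mem_range.mpr (lt_of_not_ge hi)), zero_add]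
  have hUunit : IsUnit U := by
    rw [isUnit_iff_constantCoeff, ← coeff_zero_eq_constantCoeff_apply, hU, coeff_mk, zero_add]
    exact hd
  -- `n` is nilpotent
  have hnnil : IsNilpotent n := by
    rw [hn]
    refine isNilpotent_sum fun m hm ↦ ?_
    obtain ⟨k, hk⟩ := hlow m (Finset.mem_range.mp hm)
    exact ⟨k, by rw [mul_pow, ← map_pow, hk, map_zero, zero_mul]⟩
  obtain ⟨N, hN⟩ := hnnil.neg
  -- `(X^d U)^k z = (−n)^k z`
  have hiter : ∀ k : ℕ, (X ^ d * U) ^ k * z = (-n) ^ k * z := by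
    intro k
    induction k with
    | zero => simp
    | succ k ih =>
        have h1 : X ^ d * U * z = -n * z := by
          have : (X ^ d * U + n) * z = 0 := by rw [← hf]; exact hz
          linear_combination this
        calc (X ^ d * U) ^ (k + 1) * z = (X ^ d * U) ^ k * (X ^ d * U * z) := by ring
          _ = (X ^ d * U) ^ k * (-n * z) := by rw [h1]
          _ = -n * ((X ^ d * U) ^ k * z) := by ring
          _ = -n * ((-n) ^ k * z) := by rw [ih]
          _ = (-n) ^ (k + 1) * z := by ring
  have hzero : X ^ (d * N) * (U ^ N * z) = 0 := by
    have h := hiter N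
    rw [hN, zero_mul, mul_pow, ← pow_mul] at h
    rwa [mul_assoc] at h
  have h2 := PowerSeries.eq_zero_of_X_pow_mul_eq_zero (d * N) _ hzero
  exact ((hUunit.pow N).mul_right_eq_zero).mp h2

/-! ### §2 Over an Artinian ring: coefficients generating the unit ideal ⟹ non-zero-divisor -/

/-- **Over an Artinian commutative ring, a power series whose coefficients lie in no maximal ideal is a non-zero-divisor**
(localise at each maximal ideal `J`: `B_J` is Artin local, its maximal ideal is nilpotent, and the first coefficient outside `J`
is a unit of `B_J` — §1; conclude by `eq_zero_of_localization`). [cite: AtiyahMacdonald1969, Prop. 8.4, Prop. 3.8] -/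
theorem PowerSeries.eq_zero_of_mul_eq_zero_of_isArtinianRing {B : Type*} [CommRing B] [IsArtinianRing B] (f : B⟦X⟧)
    (hf : ∀ J : Ideal B, J.IsMaximal → ∃ i, coeff i f ∉ J) (z : B⟦X⟧) (hz : f * z = 0) : z = 0 := by
  ext i
  rw [map_zero]
  refine eq_zero_of_localization (coeff i z) fun J hJ ↦ ?_
  set φ := algebraMap B (Localization.AtPrime J) with hφ
  have hzJ : PowerSeries.map φ f * PowerSeries.map φ z = 0 := by rw [← map_mul, hz, map_zero]
  -- the least coefficient of `f` outside `J`
  have hex : ∃ i, coeff i f ∉ J := hf J hJ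
  set d := Nat.find hex with hddef
  have hd : coeff d f ∉ J := Nat.find_spec hex
  have hlt : ∀ i < d, coeff i f ∈ J := fun i hi ↦ by
    have := Nat.find_min hex hi
    rwa [not_not] at this
  have hunit : IsUnit (coeff d (PowerSeries.map φ f)) := by
    rw [coeff_map]
    exact IsLocalization.map_units (Localization.AtPrime J) (⟨coeff d f, show coeff d f ∈ J.primeCompl from hd⟩ : J.primeCompl)
  have hnil : ∀ i < d, IsNilpotent (coeff i (PowerSeries.map φ f)) := by
    intro i hi
    rw [coeff_map]
    have hmem : φ (coeff i f) ∈ IsLocalRing.maximalIdeal (Localization.AtPrime J) := by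
      rw [← Localization.AtPrime.map_eq_maximalIdeal]
      exact Ideal.mem_map_of_mem _ (hlt i hi)
    obtain ⟨N, hN⟩ := IsArtinianRing.isNilpotent_jacobson_bot (R := Localization.AtPrime J)
    rw [IsLocalRing.jacobson_eq_maximalIdeal ⊥ bot_ne_top] at hN
    refine ⟨N, ?_⟩
    have h := Ideal.pow_mem_pow hmem N
    rw [hN] at h
    exact (Submodule.mem_bot _).mp h
  have h := PowerSeries.eq_zero_of_mul_eq_zero_of_isUnit_coeff_of_isNilpotent_lt _ d hunit hnil _ hzJ
  have h' := congrArg (coeff i) h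
  rwa [coeff_map, map_zero] at h'

/-! ### §3 `p` regular modulo `L` in `S⟦T⟧` from a unit coefficient of `L mod p` -/

namespace CongruenceDescent

/-- **Member-level untwisting.** `S` a commutative ring, `p ∈ S` a non-zero-divisor with `S ⧸ (p)` Artinian, `L ∈ S⟦T⟧` with a
coefficient that is a unit modulo `p` («`μ(L) = 0` in the receptacle»). Then `C p` is regular modulo `L`:
`C p · y ∈ (L) ⟹ y ∈ (L)`. (Reduce `C p · y = L z` modulo `p`: `L̄ z̄ = 0`, so `z̄ = 0` by §2, `z = C p · z′`, and cancel `C p`.)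
This is the hypothesis `hreg` of the descent kernels, in a member's receptacle. [cite: AtiyahMacdonald1969, Prop. 8.4] -/
theorem regular_C_of_isUnit_coeff_mod {S : Type*} [CommRing S] (p : S) (hp : ∀ s : S, p * s = 0 → s = 0)
    [IsArtinianRing (S ⧸ Ideal.span {p})] (L : S⟦X⟧)
    (hL : ∃ i, IsUnit (Ideal.Quotient.mk (Ideal.span {p}) (coeff i L))) :
    ∀ y : S⟦X⟧, C p * y ∈ Ideal.span {L} → y ∈ Ideal.span {L} := by
  intro y hy
  obtain ⟨z, hz⟩ := Ideal.mem_span_singleton'.mp hy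
  -- reduce modulo `p`
  set π := PowerSeries.map (Ideal.Quotient.mk (Ideal.span {p})) with hπ
  have hπp : π (C p) = 0 := by
    rw [hπ, map_C, Ideal.Quotient.eq_zero_iff_mem.mpr (Ideal.mem_span_singleton_self p), map_zero]
  have hz0 : π L * π z = 0 := by rw [← map_mul, mul_comm, hz, map_mul, hπp, zero_mul]
  have hLbar : ∀ J : Ideal (S ⧸ Ideal.span {p}), J.IsMaximal → ∃ i, coeff i (π L) ∉ J := by
    intro J hJ
    obtain ⟨i, hi⟩ := hL
    refine ⟨i, fun h ↦ hJ.ne_top (Ideal.eq_top_of_isUnit_mem J h ?_)⟩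
    rwa [hπ, coeff_map]
  have hzbar : π z = 0 := PowerSeries.eq_zero_of_mul_eq_zero_of_isArtinianRing (π L) hLbar (π z) hz0
  -- `z = C p · z'`
  have hdvd : C p ∣ z := by
    rw [Literature.NumberTheory.EllipticCurves.PowerSeries.C_dvd_iff_forall_dvd_coeff]
    intro n
    have h := congrArg (coeff n) hzbar
    rw [hπ, coeff_map, map_zero, Ideal.Quotient.eq_zero_iff_mem, Ideal.mem_span_singleton] at h
    exact h
  obtain ⟨z', rfl⟩ := hdvd
  -- cancel `C p`
  have hC : ∀ w : S⟦X⟧, C p * w = 0 → w = 0 := by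
    intro w hw
    ext n
    have h := congrArg (coeff n) hw
    rw [coeff_C_mul, map_zero] at h
    rw [map_zero]
    exact hp _ h
  have hyz : y = L * z' := by
    have h0 : C p * (y - L * z') = 0 := by rw [mul_sub, ← hz]; ring
    exact sub_eq_zero.mp (hC _ h0)
  rw [hyz]
  exact Ideal.mul_mem_right _ _ (Ideal.mem_span_singleton_self L)

end CongruenceDescent

end Summit.BirchSwinnertonDyer.Rank1Residual.X11b

end
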